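import Summits.Ventures.CertifiedArithmetic.LowPrec.GemmPrecRounding
import Summits.Ventures.CertifiedArithmetic.LowPrec.GemmThetaLawGenSemPsi

/-!
# Letter-dependent symbolic θ-certificates: the symbolic step is the rounded step

HONEST FRAMING (venture CertifiedArithmetic / cell `pub-lowprec`, seat gemm, gen 12 → 13): certified
error envelopes and provably optimal rounding/accumulation schemes for low-precision formats under
stated cost models; every table by two implementations; no hardware or vendor claims.

Step (S3, first part) of the soundness chain for `GemmThetaLawGenDefs.lean` (cell HANDOFF decision
35; `code/gemm/thetalaw/GENDEFS-CONTRACT.md` §4): at every parameter `(K, T)` of a class domain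
(`M = M₀K = 2H = 2^m`, `K` even), whenever `target d n tc = some tg`:
`target_rneZ` — the result form `tg.W` evaluates to `rneZ m n` = the integer round-to-nearest-even
of the exact (frame) sum `n` (`GemmPrecRounding.rneZ`, hence `fl_φ` by `flStep_grid_prec`);
`target_stZ` — with `closureOK`, the result is a state (`LawData.stZ`); `target_psi_pos` — for a
positive state and no sign flip the checker's ψ-form of the result evaluates to `LawData.psiZ` of
the result; `target_psi_flip` / `target_W_nonneg` — the sign-flip and negative-frame cases, where
ψ is the magnitude.  What remains for S3 proper is bookkeeping: frame ↔ true sign (`rneZ_neg`),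
the source state's ψ (`psiLevel_bin_sound` again) and reading the seven inequalities of `clsOK`
through `nonnegOnI_sound`.
-/

namespace Literature.ComputerArithmetic.FloatingPoint

namespace MiniFloat

namespace ThetaLaw

namespace LawData

variable (L : LawData)

open AForm

/-- THE SYMBOLIC STEP IS THE ROUNDED STEP: the result form evaluates to `rneZ m` of the sum.
[cell] -/
theorem target_rneZ {m : ℕ} {K T : ℤ} {d : IDom} (hd : d.mem K T) (hev : 2 ∣ K)
    (hM : (2 : ℤ) ^ m = L.M0 * K) {n : AForm} {tc : TCode} {tg : TgtI}
    (h : L.target d n tc = some tg) : rneZ m (n.eval K T) = tg.W.eval K T := by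
  have h2m : (2 : ℤ) ^ (m + 1) = 2 * (L.M0 * K) := by rw [pow_succ, hM]; ring
  cases tc with
  | xpos =>
    obtain ⟨rfl, h0, h1⟩ := L.target_xpos_sound hd h
    have hlt : n.eval K T < 2 ^ (m + 1) := by rw [h2m]; linarith
    have hna : (n.eval K T).natAbs < 2 ^ (m + 1) := by
      have : (((n.eval K T).natAbs : ℕ) : ℤ) < 2 ^ (m + 1) := by
        rw [Int.natAbs_of_nonneg h0]; exact hlt
      exact_mod_cast this
    unfold rneZ rneSigMag
    rw [if_neg (not_lt.mpr h0), if_pos hna]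
    simp only [Int.natAbs_of_nonneg h0]
  | xneg =>
    obtain ⟨rfl, h0, h1⟩ := L.target_xneg_sound hd h
    have hna : (n.eval K T).natAbs < 2 ^ (m + 1) := by
      have : (((n.eval K T).natAbs : ℕ) : ℤ) < 2 ^ (m + 1) := by
        rw [Int.ofNat_natAbs_of_nonpos (by omega), h2m]; linarith
      exact_mod_cast this
    unfold rneZ rneSigMag
    rw [if_pos (by omega), if_pos hna]
    simp only [Int.ofNat_natAbs_of_nonpos (show n.eval K T ≤ 0 by omega), neg_neg]
  | bin e =>
    obtain ⟨sig, rfl, -, -, -, -, h3, h4⟩ := L.target_bin_sound hd hev hM h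
    have hna : (n.eval K T).natAbs = (n.eval K T).toNat := by omega
    unfold rneZ
    rw [if_neg (not_lt.mpr h3), hna, h4]
    simp only [eval_smul]
    ring

/-- The result form is non-negative unless the sign flipped. [cell] -/
theorem target_W_nonneg {m : ℕ} {K T : ℤ} {d : IDom} (hd : d.mem K T) (hev : 2 ∣ K)
    (hM : (2 : ℤ) ^ m = L.M0 * K) {n : AForm} {tc : TCode} {tg : TgtI}
    (h : L.target d n tc = some tg) (hneg : tg.neg = false) : 0 ≤ tg.W.eval K T := by
  cases tc with
  | xpos => obtain ⟨rfl, h0, -⟩ := L.target_xpos_sound hd h; exact h0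
  | xneg => obtain ⟨rfl, -, -⟩ := L.target_xneg_sound hd h; simp at hneg
  | bin e =>
    obtain ⟨sig, rfl, -, -, h1, -, -, -⟩ := L.target_bin_sound hd hev hM h
    have hMK : 0 < L.M0 * K := by rw [← hM]; positivity
    simp only [eval_smul]
    have : (0 : ℤ) < 2 ^ e := by positivity
    nlinarith

/-- WITH CLOSURE, THE RESULT IS A STATE. [cell] -/
theorem target_stZ {m : ℕ} {K T : ℤ} {d : IDom} (hd : d.mem K T) (hev : 2 ∣ K)
    (hM : (2 : ℤ) ^ m = L.M0 * K) {n : AForm} {tc : TCode} {tg : TgtI}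
    (h : L.target d n tc = some tg) (hcl : L.closureOK d tg = true) :
    L.stZ m (tg.W.eval K T) := by
  have h2m : (2 : ℤ) ^ (m + 1) = 2 * (L.M0 * K) := by rw [pow_succ, hM]; ring
  cases tc with
  | xpos =>
    obtain ⟨rfl, h0, h1⟩ := L.target_xpos_sound hd h
    refine Or.inl ?_
    have : (((n.eval K T).natAbs : ℕ) : ℤ) < 2 ^ (m + 1) := by
      rw [Int.natAbs_of_nonneg h0, h2m]; linarith
    exact_mod_cast this
  | xneg =>
    obtain ⟨rfl, h0, h1⟩ := L.target_xneg_sound hd h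
    refine Or.inl ?_
    have : (((n.eval K T).natAbs : ℕ) : ℤ) < 2 ^ (m + 1) := by
      rw [Int.ofNat_natAbs_of_nonpos (by omega), h2m]; linarith
    exact_mod_cast this
  | bin e =>
    obtain ⟨sig, rfl, he1, he2, h1, h2, -, -⟩ := L.target_bin_sound hd hev hM h
    obtain ⟨htop, hbin⟩ := L.closureOK_sound hd hcl
    simp only [levOfE] at htop hbin
    have hMK : 0 < L.M0 * K := by rw [← hM]; positivity
    -- the trailing significand `t' = sig - M`, as a natural number
    set t := (sig.eval K T - L.M0 * K).toNat with ht
    have htz : (t : ℤ) = sig.eval K T - L.M0 * K := Int.toNat_of_nonneg (by linarith)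
    have hW : ((smul (2 ^ e) sig).eval K T).natAbs = (2 ^ m + t) * 2 ^ (e - 1 + 1) := by
      have hW0 : 0 ≤ (smul (2 ^ e) sig).eval K T := by
        simp only [eval_smul]; have : (0 : ℤ) < 2 ^ e := by positivity
        nlinarith
      have : ((((smul (2 ^ e) sig).eval K T).natAbs : ℕ) : ℤ) =
          (((2 ^ m + t) * 2 ^ (e - 1 + 1) : ℕ) : ℤ) := by
        rw [Int.natAbs_of_nonneg hW0, show e - 1 + 1 = e by omega]
        push_cast
        rw [htz, hM, eval_smul]; ring
      exact_mod_cast this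
    by_cases hj : e - 1 ≤ L.J
    · -- regular or full binade `j = e - 1`
      obtain ⟨-, htM⟩ := hbin (e - 1) (by rw [if_pos hj])
      simp only [eval_sub, eval_hH] at htM
      refine Or.inr ⟨e - 1, t, hj, ?_, hW⟩
      have : (t : ℤ) ≤ 2 ^ m := by rw [htz, hM]; linarith
      exact_mod_cast this
    · -- the top: `e = J + 2`, `t' = 0`, i.e. binade `J` at `t = M`
      have ht0 := htop (by rw [if_neg hj])
      simp only [eval_sub, eval_hH] at ht0
      have htt : t = 0 := by
        have : (t : ℤ) = 0 := by rw [htz]; linarith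
        exact_mod_cast this
      have heJ : e = L.J + 2 := by omega
      refine Or.inr ⟨L.J, 2 ^ m, le_rfl, le_rfl, ?_⟩
      rw [hW, htt, heJ]
      rw [show L.J + 2 - 1 + 1 = (L.J + 1) + 1 by omega, pow_succ]
      ring

/-- ψ OF THE RESULT, positive state, no sign flip: the checker's form is `psiZ` of the result.
[cell] -/
theorem target_psi_pos (hc : L.contOK = true) {m : ℕ} {H K T : ℤ} (hM2 : (2 : ℤ) ^ m = 2 * H)
    (hMK : L.M0 * K = 2 * H) {d : IDom} (hd : d.mem K T) (hev : 2 ∣ K) {n : AForm}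
    {tc : TCode} {tg : TgtI} (h : L.target d n tc = some tg) (hcl : L.closureOK d tg = true)
    (hneg : tg.neg = false) {f : AForm} (hf : L.psiLevel tg.lev tg.tf d = some f) :
    f.eval K T = L.psiZ m (tg.W.eval K T) := by
  have hM : (2 : ℤ) ^ m = L.M0 * K := by rw [hM2, hMK]
  cases tc with
  | xpos =>
    obtain ⟨rfl, h0, h1⟩ := L.target_xpos_sound hd h
    simp only [psiLevel_Q, Option.some.injEq] at hf
    subst hf
    rw [L.psiZ_of_small m h0 (by rw [pow_succ, hM]; linarith)]
  | xneg =>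
    obtain ⟨rfl, -, -⟩ := L.target_xneg_sound hd h; simp at hneg
  | bin e =>
    obtain ⟨sig, rfl, he1, he2, h1, h2, -, -⟩ := L.target_bin_sound hd hev hM h
    obtain ⟨htop, hbin⟩ := L.closureOK_sound hd hcl
    simp only [levOfE] at htop hbin hf
    by_cases hj : e - 1 ≤ L.J
    · rw [if_pos hj] at hf
      obtain ⟨-, -, hfe⟩ := L.psiLevel_bin_sound hc hM2 hMK hd hj hf
      rw [hfe]
      congr 1
      simp only [eval_sub, eval_hH, eval_smul]
      rw [hMK, show e - 1 + 1 = e by omega]; ring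
    · rw [if_neg hj] at hf
      obtain ⟨ht0, hfe⟩ := L.psiLevel_top_sound hc hM2 hMK hd hf
      simp only [eval_sub, eval_hH] at ht0
      rw [hfe]
      congr 1
      simp only [eval_smul]
      rw [show e = L.J + 1 + 1 by omega, show sig.eval K T = 2 * H by linarith]
      ring

/-- ψ OF THE RESULT after a sign flip (exact negative frame result `n ≤ -1`): in either true sign
the potential is the magnitude `-n`, which is the checker's `tg.tf`. [cell] -/
theorem target_psi_flip {m : ℕ} {K T : ℤ} {d : IDom} (hd : d.mem K T)
    (hM : (2 : ℤ) ^ m = L.M0 * K) {n : AForm} {tg : TgtI}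
    (h : L.target d n TCode.xneg = some tg) {s : ℤ} (hs : s = 1 ∨ s = -1) :
    L.psiZ m (s * tg.W.eval K T) = tg.tf.eval K T := by
  obtain ⟨rfl, h0, h1⟩ := L.target_xneg_sound hd h
  simp only [eval_smul]
  rcases hs with rfl | rfl
  · rw [one_mul, L.psiZ_of_neg m (by omega)]; ring
  · rw [show (-1 : ℤ) * n.eval K T = -(n.eval K T) by ring,
      L.psiZ_of_small m (by omega) (by rw [pow_succ, hM]; linarith)]

/-- ψ OF THE RESULT for a negative state without sign flip: the true result `-W ≤ 0` has
potential `W`, which is the checker's `tg.W`. [cell] -/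
theorem target_psi_negframe {m : ℕ} {K T : ℤ} {d : IDom} (hd : d.mem K T) (hev : 2 ∣ K)
    (hM : (2 : ℤ) ^ m = L.M0 * K) {n : AForm} {tc : TCode} {tg : TgtI}
    (h : L.target d n tc = some tg) (hneg : tg.neg = false) :
    L.psiZ m (-(tg.W.eval K T)) = tg.W.eval K T :=
  L.psiZ_neg_of_nonneg m (L.target_W_nonneg hd hev hM h hneg)

end LawData

end ThetaLaw

end MiniFloat

end Literature.ComputerArithmetic.FloatingPoint
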